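import Summits.ResolutionOfSingularities.ResolutionOfSingularities.Theorems.WildQuotientsSummitReductionStubPairOrbitNormalFormBlowupChartsOverCentreSection
import Summits.ResolutionOfSingularities.ResolutionOfSingularities.Theorems.WildQuotientsSummitReductionStubPairOrbitNormalFormBlowupChartsOverCentreElim
import Literature.AlgebraicGeometry.Resolution.FormalFibresRegularProofs
import Literature.AlgebraicGeometry.Resolution.CompleteFiniteness
import Literature.AlgebraicGeometry.Resolution.AdicQuotient
import Literature.AlgebraicGeometry.Resolution.AdicCompletionRegular
import Literature.AlgebraicGeometry.Resolution.AlterationsSemiStableCodimTwoBlowupFibreModels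
import Mathlib.RingTheory.KrullDimension.NonZeroDivisors
import Mathlib.RingTheory.MvPowerSeries.NoZeroDivisors
import HarnessLib

/-!
# `WildQuotients.SummitReduction` (stmt-ResolutionOfSingularities-16324), line `FramePerfect`, stub O3
# (`stub_pair_orbitNormalFormBlowup_chartsOverCentre`): `Â₁⟦U, V⟧ ≅ L̂` at the nodes of the
# blown-up model

Route `ResolutionOfSingularities/WildQuotients`, crux `SummitReduction`; helper file of stub O3
(de Jong 1996, 4.27 [C2] on the coefficient-free model; the retract `chartsOverCentre_section`
in `…ChartsOverCentreSection.lean`). On the chart "`t₁ ≠ 0`" of the blow-up of the model, at a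
closed point `𝔔 ∋ u' = X₀/x, v' = X₁/x` over the closed point (a point of the new double locus),
de Jong (p. 76) reads off "`u'v' - t₂'t₃ ⋯ t_s = 0` … again of normal form" with the NEW base the
blown-up old base. Coefficient-free this is the KEY SIMPLIFICATION, PROVED here:

* `chartsOverCentre_nodePresentation` — with `A' = Â₁` the completion of the chart
  `A[(x, y)/x]` of the blown-up base at `𝔔₁ = λ⁻¹𝔔`, the map `Â₁⟦U, V⟧ → L̂`, `U ↦ X₀/x`,
  `V ↦ X₁/x` (substitution into the complete `L̂`), is an ISOMORPHISM: onto by Matsumura 8.4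
  (`𝔪_{L̂} = (X₀/x, X₁/x) + 𝔪_{Â₁} L̂`, equal residue fields — `chartsOverCentre_section_local`),
  into as a surjection of a domain of dimension `≤ dim Â₁ + 2 = dim L̂`
  (`chartsOverCentre_ringKrullDim_mvPowerSeries_le`,
  `chartsOverCentre_injective_of_surjective_of_ringKrullDim_le`).

## Sources

* A. J. de Jong, *Smoothness, semi-stability and alterations*, Publ. Math. IHÉS 83 (1996), 4.27,
  p. 76; 2.23, p. 62. [DeJong1996]
* A. J. de Jong, *Families of curves and alterations*, Ann. Inst. Fourier 47 (1997), proof of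
  Prop. 5.11, p. 619. [DeJong1997]
* H. Matsumura, *Commutative Ring Theory* (1986), Thms. 8.4, 15.1, 15.4. [Matsumura1987]
-/

set_option linter.dupNamespace false -- the tree's summit namespace repeats `ResolutionOfSingularities`

noncomputable section

open IsLocalRing
open Literature.AlgebraicGeometry.Resolution
open Literature.NumberTheory.GaloisRepresentations.NearlyOrdinaryPresentationCA

namespace Summit.ResolutionOfSingularities.ResolutionOfSingularities.Theorems

/-- `chartsOverCentre_ringKrullDim_chart` with the chart element given up to equality. [folklore] -/
theorem chartsOverCentre_ringKrullDim_chart_of_eq {R : Type} [CommRing R] [IsRegularLocalRing R]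
    {n : ℕ} (c : Fin n → R) (j : Fin n) {l : ℕ} (w : Fin l → R)
    (hz : Ideal.span (Set.range (Fin.append c w)) = maximalIdeal R)
    (hd : (maximalIdeal R).spanFinrank = n + l)
    (𝔓 : Ideal R) (h𝔓 : 𝔓 = Ideal.span (Set.range c)) (hc : ∀ k, c k ∈ 𝔓) (b : R) (hb : c j = b)
    (𝔔 : Ideal (blowupAlgebra 𝔓 b)) [𝔔.IsMaximal]
    (h𝔔 : 𝔔.comap (algebraMap R _) = maximalIdeal R)
    (L : Type) [CommRing L] [IsLocalRing L] [Algebra (blowupAlgebra 𝔓 b) L]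
    [IsLocalization.AtPrime L 𝔔] :
    ringKrullDim L = ((n - 1) + (l + 1) : ℕ) := by
  subst hb
  exact chartsOverCentre_ringKrullDim_chart c j w hz hd 𝔓 h𝔓 hc 𝔔 h𝔔 L

/-- **`dim A⟦X₁, …, X_n⟧ ≤ dim A + n`** for a regular local ring `A`: the maximal ideal
`𝔪_A A⟦X⟧ + (X)` needs at most `emb dim A + n` generators. [cite: Matsumura1987, Thm. 15.4] -/
theorem chartsOverCentre_ringKrullDim_mvPowerSeries_le (A : Type) [CommRing A] [IsRegularLocalRing A]
    (n : ℕ) : ringKrullDim (MvPowerSeries (Fin n) A) ≤ ringKrullDim A + n := by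
  classical
  haveI := isRegularLocalRing_mvPowerSeries_of_isRegularLocalRing A n
  have fg' := (maximalIdeal A).fg_of_isNoetherianRing
  have fg := Submodule.FG.finite_generators fg'
  have hspan : maximalIdeal (MvPowerSeries (Fin n) A) =
      Ideal.span ((MvPowerSeries.C (σ := Fin n) (R := A)) '' (maximalIdeal A).generators ∪
        Set.range (MvPowerSeries.X : Fin n → MvPowerSeries (Fin n) A)) := by
    rw [maximalIdeal_mvPowerSeries_eq A n, Ideal.span_union, ← Ideal.map_span]
    congr 2
    exact ((maximalIdeal A).span_generators).symm
  have hfin : ((MvPowerSeries.C (σ := Fin n) (R := A)) '' (maximalIdeal A).generators ∪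
      Set.range (MvPowerSeries.X : Fin n → MvPowerSeries (Fin n) A)).Finite :=
    (fg.image _).union (Set.finite_range _)
  have h1 : ((maximalIdeal (MvPowerSeries (Fin n) A)).spanFinrank : WithBot ℕ∞) ≤
      ((maximalIdeal A).spanFinrank + n : ℕ) := by
    rw [hspan]
    have := Submodule.spanFinrank_span_le_ncard_of_finite (R := MvPowerSeries (Fin n) A)
      (M := MvPowerSeries (Fin n) A) hfin
    refine (Nat.cast_le.mpr (this.trans ?_))
    refine (Set.ncard_union_le _ _).trans (add_le_add ?_ ?_)
    · rw [← Submodule.FG.generators_ncard fg']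
      exact Set.ncard_image_le fg
    · rw [← Set.image_univ]
      refine (Set.ncard_image_le Set.finite_univ).trans ?_
      rw [Set.ncard_univ, Nat.card_eq_fintype_card, Fintype.card_fin]
  rw [← IsRegularLocalRing.spanFinrank_maximalIdeal (R := MvPowerSeries (Fin n) A),
    ← IsRegularLocalRing.spanFinrank_maximalIdeal (R := A)]
  refine h1.trans ?_
  push_cast
  exact le_rfl

/-- **A surjection of a domain onto a ring of at least its (finite) dimension is injective.**
[folklore] -/
theorem chartsOverCentre_injective_of_surjective_of_ringKrullDim_le {R S : Type} [CommRing R] [CommRing S]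
    [IsDomain R] (f : R →+* S) (hf : Function.Surjective f) {d : ℕ} (hS : ringKrullDim S = d)
    (hR : ringKrullDim R ≤ d) : Function.Injective f := by
  rw [injective_iff_map_eq_zero]
  by_contra h
  simp only [not_forall] at h
  obtain ⟨r, hr0, hr⟩ := h
  have hmem : r ∈ nonZeroDivisors R := mem_nonZeroDivisors_of_ne_zero hr
  have h1 := ringKrullDim_quotient_succ_le_of_nonZeroDivisor hmem
  -- `S` is a quotient of `R/(r)`
  have h2 : ringKrullDim S ≤ ringKrullDim (R ⧸ Ideal.span {r}) := by
    refine ringKrullDim_le_of_surjective (Ideal.Quotient.lift (Ideal.span {r}) f ?_) ?_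
    · intro a ha
      obtain ⟨c, rfl⟩ := Ideal.mem_span_singleton.mp ha
      rw [map_mul, hr0, zero_mul]
    · intro s
      obtain ⟨a, rfl⟩ := hf s
      exact ⟨Ideal.Quotient.mk _ a, rfl⟩
  rw [hS] at h2
  have h3 : (d : WithBot ℕ∞) + 1 ≤ d :=
    ((add_le_add h2 le_rfl).trans h1).trans hR
  have h4 : ((d + 1 : ℕ) : WithBot ℕ∞) ≤ (d : ℕ) := by push_cast; exact h3
  exact absurd (WithBot.coe_le_coe.mp h4) (by
    intro h
    have := ENat.coe_le_coe.mp h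
    omega)

/-- **The KEY SIMPLIFICATION: `Â₁⟦U, V⟧ ≅ L̂` at a closed point of the new double locus** (de Jong
1996, p. 76, chart "`t₁ ≠ 0`": the completed local ring of the blown-up model at a closed point
`𝔔 ∋ u', v'` over the closed point is a power series ring in `u' = X₀/x`, `v' = X₁/x` over the
NEW base `A' = Â₁`, the completion of the chart `A[(x, y)/x]` of the blown-up base at
`𝔔₁ = λ⁻¹𝔔`): the map `U ↦ X₀/x`, `V ↦ X₁/x` over `Â₁ → L̂` is onto by Matsumura 8.4
(`𝔪_{L̂} = (X₀/x, X₁/x) + 𝔪_{Â₁} L̂` and equal residue fields, `chartsOverCentre_section_local`)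
and into by dimension (`dim Â₁⟦U, V⟧ ≤ dim Â₁ + 2 = dim L̂`, a surjection of a domain).
[cite: DeJong1996, 4.27, p. 76] [cite: Matsumura1987, Thm. 8.4] -/
theorem chartsOverCentre_nodePresentation {A : Type} [CommRing A] [IsRegularLocalRing A] {l : ℕ}
    (x y : A) (w : Fin l → A)
    (hzA : Ideal.span (Set.range (Fin.append ![x, y] w)) = maximalIdeal A)
    (hdA : (maximalIdeal A).spanFinrank = 2 + l)
    (hy : y ∈ (Ideal.span (Set.range ![x, y]))) (h0 : MvPowerSeries.X 0 ∈ (Ideal.span (Set.range (![MvPowerSeries.X 0, MvPowerSeries.X 1, MvPowerSeries.C x, MvPowerSeries.C y] : Fin 4 → MvPowerSeries (Fin 2) A)))) (h1 : MvPowerSeries.X 1 ∈ (Ideal.span (Set.range (![MvPowerSeries.X 0, MvPowerSeries.X 1, MvPowerSeries.C x, MvPowerSeries.C y] : Fin 4 → MvPowerSeries (Fin 2) A))))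
    (h3 : MvPowerSeries.C y ∈ (Ideal.span (Set.range (![MvPowerSeries.X 0, MvPowerSeries.X 1, MvPowerSeries.C x, MvPowerSeries.C y] : Fin 4 → MvPowerSeries (Fin 2) A))))
    (𝔔 : Ideal (blowupAlgebra (Ideal.span (Set.range (![MvPowerSeries.X 0, MvPowerSeries.X 1, MvPowerSeries.C x, MvPowerSeries.C y] : Fin 4 → MvPowerSeries (Fin 2) A))) (MvPowerSeries.C x))) [𝔔.IsMaximal]
    (h𝔔 : 𝔔.comap (algebraMap (MvPowerSeries (Fin 2) A) (blowupAlgebra (Ideal.span (Set.range (![MvPowerSeries.X 0, MvPowerSeries.X 1, MvPowerSeries.C x, MvPowerSeries.C y] : Fin 4 → MvPowerSeries (Fin 2) A))) (MvPowerSeries.C x))) = maximalIdeal (MvPowerSeries (Fin 2) A))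
    (he0 : blowupAlgebra.gen (Ideal.span (Set.range (![MvPowerSeries.X 0, MvPowerSeries.X 1, MvPowerSeries.C x, MvPowerSeries.C y] : Fin 4 → MvPowerSeries (Fin 2) A))) (MvPowerSeries.C x) (MvPowerSeries.X 0) h0 ∈ 𝔔) (he1 : blowupAlgebra.gen (Ideal.span (Set.range (![MvPowerSeries.X 0, MvPowerSeries.X 1, MvPowerSeries.C x, MvPowerSeries.C y] : Fin 4 → MvPowerSeries (Fin 2) A))) (MvPowerSeries.C x) (MvPowerSeries.X 1) h1 ∈ 𝔔)
    (L : Type) [CommRing L] [IsLocalRing L] [Algebra (blowupAlgebra (Ideal.span (Set.range (![MvPowerSeries.X 0, MvPowerSeries.X 1, MvPowerSeries.C x, MvPowerSeries.C y] : Fin 4 → MvPowerSeries (Fin 2) A))) (MvPowerSeries.C x)) L] [IsLocalization.AtPrime L 𝔔] :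
    ∃ (lam : blowupAlgebra (Ideal.span (Set.range ![x, y])) x →+* blowupAlgebra (Ideal.span (Set.range (![MvPowerSeries.X 0, MvPowerSeries.X 1, MvPowerSeries.C x, MvPowerSeries.C y] : Fin 4 → MvPowerSeries (Fin 2) A))) (MvPowerSeries.C x)) (𝔔₁ : Ideal (blowupAlgebra (Ideal.span (Set.range ![x, y])) x)) (_ : 𝔔₁.IsMaximal) (_ : 𝔔₁ = 𝔔.comap lam),
      (∀ a : A, lam (algebraMap A _ a) = algebraMap (MvPowerSeries (Fin 2) A) (blowupAlgebra (Ideal.span (Set.range (![MvPowerSeries.X 0, MvPowerSeries.X 1, MvPowerSeries.C x, MvPowerSeries.C y] : Fin 4 → MvPowerSeries (Fin 2) A))) (MvPowerSeries.C x)) (MvPowerSeries.C a)) ∧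
      lam (blowupAlgebra.gen (Ideal.span (Set.range ![x, y])) x y hy) = blowupAlgebra.gen (Ideal.span (Set.range (![MvPowerSeries.X 0, MvPowerSeries.X 1, MvPowerSeries.C x, MvPowerSeries.C y] : Fin 4 → MvPowerSeries (Fin 2) A))) (MvPowerSeries.C x) (MvPowerSeries.C y) h3 ∧
      𝔔₁.comap (algebraMap A (blowupAlgebra (Ideal.span (Set.range ![x, y])) x)) = maximalIdeal A ∧
      ∀ (L1 : Type) [CommRing L1] [IsLocalRing L1] [Algebra (blowupAlgebra (Ideal.span (Set.range ![x, y])) x) L1] [IsLocalization.AtPrime L1 𝔔₁],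
      ∃ (Φ : MvPowerSeries (Fin 2) (LocalCpl L1) ≃+* LocalCpl L),
        (∀ a₁ : blowupAlgebra (Ideal.span (Set.range ![x, y])) x, Φ (MvPowerSeries.C (σ := Fin 2) (R := LocalCpl L1)
            (algebraMap L1 (LocalCpl L1) (algebraMap (blowupAlgebra (Ideal.span (Set.range ![x, y])) x) L1 a₁))) =
          algebraMap L (LocalCpl L) (algebraMap (blowupAlgebra (Ideal.span (Set.range (![MvPowerSeries.X 0, MvPowerSeries.X 1, MvPowerSeries.C x, MvPowerSeries.C y] : Fin 4 → MvPowerSeries (Fin 2) A))) (MvPowerSeries.C x)) L (lam a₁))) ∧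
        Φ (MvPowerSeries.X (σ := Fin 2) (R := LocalCpl L1) 0) = algebraMap L (LocalCpl L) (algebraMap (blowupAlgebra (Ideal.span (Set.range (![MvPowerSeries.X 0, MvPowerSeries.X 1, MvPowerSeries.C x, MvPowerSeries.C y] : Fin 4 → MvPowerSeries (Fin 2) A))) (MvPowerSeries.C x)) L (blowupAlgebra.gen (Ideal.span (Set.range (![MvPowerSeries.X 0, MvPowerSeries.X 1, MvPowerSeries.C x, MvPowerSeries.C y] : Fin 4 → MvPowerSeries (Fin 2) A))) (MvPowerSeries.C x) (MvPowerSeries.X 0) h0)) ∧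
        Φ (MvPowerSeries.X (σ := Fin 2) (R := LocalCpl L1) 1) = algebraMap L (LocalCpl L) (algebraMap (blowupAlgebra (Ideal.span (Set.range (![MvPowerSeries.X 0, MvPowerSeries.X 1, MvPowerSeries.C x, MvPowerSeries.C y] : Fin 4 → MvPowerSeries (Fin 2) A))) (MvPowerSeries.C x)) L (blowupAlgebra.gen (Ideal.span (Set.range (![MvPowerSeries.X 0, MvPowerSeries.X 1, MvPowerSeries.C x, MvPowerSeries.C y] : Fin 4 → MvPowerSeries (Fin 2) A))) (MvPowerSeries.C x) (MvPowerSeries.X 1) h1)) := by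
  classical
  haveI hP := isRegularLocalRing_mvPowerSeries_of_isRegularLocalRing A 2
  obtain ⟨hzP, hdP⟩ := chartsOverCentre_model_rsop x y w hzA hdA
  have hc : ∀ k, (![MvPowerSeries.X 0, MvPowerSeries.X 1, MvPowerSeries.C x, MvPowerSeries.C y] : Fin 4 → MvPowerSeries (Fin 2) A) k ∈ (Ideal.span (Set.range (![MvPowerSeries.X 0, MvPowerSeries.X 1, MvPowerSeries.C x, MvPowerSeries.C y] : Fin 4 → MvPowerSeries (Fin 2) A))) := fun k => Ideal.subset_span ⟨k, rfl⟩
  -- Noetherianity of the charts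
  haveI hBchN : IsNoetherianRing (blowupAlgebra (Ideal.span (Set.range (![MvPowerSeries.X 0, MvPowerSeries.X 1, MvPowerSeries.C x, MvPowerSeries.C y] : Fin 4 → MvPowerSeries (Fin 2) A))) (MvPowerSeries.C x)) := by
    obtain ⟨Λ, -, -⟩ := chartsOverCentre_exists_reesChart_equiv (![MvPowerSeries.X 0, MvPowerSeries.X 1, MvPowerSeries.C x, MvPowerSeries.C y] : Fin 4 → MvPowerSeries (Fin 2) A) 2 (Ideal.span (Set.range (![MvPowerSeries.X 0, MvPowerSeries.X 1, MvPowerSeries.C x, MvPowerSeries.C y] : Fin 4 → MvPowerSeries (Fin 2) A))) rfl hc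
    haveI : IsNoetherianRing (chartRing (![MvPowerSeries.X 0, MvPowerSeries.X 1, MvPowerSeries.C x, MvPowerSeries.C y] : Fin 4 → MvPowerSeries (Fin 2) A) 2) := isNoetherianRing_blowupChart (![MvPowerSeries.X 0, MvPowerSeries.X 1, MvPowerSeries.C x, MvPowerSeries.C y] : Fin 4 → MvPowerSeries (Fin 2) A) 2
    exact isNoetherianRing_of_ringEquiv (chartRing (![MvPowerSeries.X 0, MvPowerSeries.X 1, MvPowerSeries.C x, MvPowerSeries.C y] : Fin 4 → MvPowerSeries (Fin 2) A) 2) Λ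
  have hcA : ∀ k, (![x, y] : Fin 2 → A) k ∈ (Ideal.span (Set.range ![x, y])) := fun k => Ideal.subset_span ⟨k, rfl⟩
  haveI hA1N : IsNoetherianRing (blowupAlgebra (Ideal.span (Set.range ![x, y])) x) := by
    obtain ⟨Λ, -, -⟩ := chartsOverCentre_exists_reesChart_equiv (![x, y] : Fin 2 → A) 0 (Ideal.span (Set.range ![x, y])) rfl hcA
    haveI : IsNoetherianRing (chartRing (![x, y] : Fin 2 → A) 0) := isNoetherianRing_blowupChart _ 0
    exact isNoetherianRing_of_ringEquiv (chartRing (![x, y] : Fin 2 → A) 0) Λ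
  haveI hLN : IsNoetherianRing L := IsLocalization.isNoetherianRing 𝔔.primeCompl L hBchN
  -- the retract and the point `𝔔₁` of the base chart
  obtain ⟨lam, phi, hsec, hsurj, hlamC, hlam3, ha, hb, hmax, hd, he, hf⟩ :=
    chartsOverCentre_section_local x y w hzA hdA hy h0 h1 h3 𝔔 h𝔔 he0 he1 L
  refine ⟨lam, 𝔔.comap lam, hmax, rfl, hlamC, hlam3, hd, ?_⟩
  intro L1 _ _ _ _
  haveI hL1N : IsNoetherianRing L1 := IsLocalization.isNoetherianRing (𝔔.comap lam).primeCompl L1 hA1N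
  -- `L1` is regular local of dimension `l + 2`
  have hrs1 := chartsOverCentre_isRsopPart_chartFamily_of_eq (![x, y] : Fin 2 → A) 0 w hzA hdA (Ideal.span (Set.range ![x, y])) rfl hcA
    x rfl (𝔔.comap lam) hd L1 (a := 0) Fin.elim0 (Function.injective_of_subsingleton _)
    (fun t => Fin.elim0 t)
  haveI hL1reg : IsRegularLocalRing L1 := hrs1.isRegularLocalRing
  have hdim1 : ringKrullDim L1 = ((2 - 1) + (l + 1) : ℕ) :=
    chartsOverCentre_ringKrullDim_chart_of_eq (![x, y] : Fin 2 → A) 0 w hzA hdA (Ideal.span (Set.range ![x, y])) rfl hcA x rfl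
      (𝔔.comap lam) hd L1
  have hdimL : ringKrullDim L = ((4 - 1) + (l + 1) : ℕ) :=
    chartsOverCentre_ringKrullDim_chart_of_eq (![MvPowerSeries.X 0, MvPowerSeries.X 1, MvPowerSeries.C x, MvPowerSeries.C y] : Fin 4 → MvPowerSeries (Fin 2) A) 2 (fun k => MvPowerSeries.C (w k)) hzP hdP (Ideal.span (Set.range (![MvPowerSeries.X 0, MvPowerSeries.X 1, MvPowerSeries.C x, MvPowerSeries.C y] : Fin 4 → MvPowerSeries (Fin 2) A))) rfl hc
      (MvPowerSeries.C x) rfl 𝔔 h𝔔 L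
  -- the local map `L1 → L`
  have hS : (𝔔.comap lam).primeCompl ≤ 𝔔.primeCompl.comap lam := fun s hs => hs
  let lamL : L1 →+* L := IsLocalization.map L lam hS
  have hlamL : ∀ a₁, lamL (algebraMap (blowupAlgebra (Ideal.span (Set.range ![x, y])) x) L1 a₁) = algebraMap (blowupAlgebra (Ideal.span (Set.range (![MvPowerSeries.X 0, MvPowerSeries.X 1, MvPowerSeries.C x, MvPowerSeries.C y] : Fin 4 → MvPowerSeries (Fin 2) A))) (MvPowerSeries.C x)) L (lam a₁) := fun a₁ => IsLocalization.map_eq hS a₁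
  have hmaple : (maximalIdeal L1).map lamL ≤ maximalIdeal L := by
    rw [← IsLocalization.AtPrime.map_eq_maximalIdeal (𝔔.comap lam) L1, Ideal.map_map,
      Ideal.map_le_iff_le_comap]
    intro a ha'
    rw [Ideal.mem_comap, RingHom.comp_apply, hlamL, IsLocalization.AtPrime.to_map_mem_maximal_iff L 𝔔]
    exact ha'
  -- the completions
  let lamh : LocalCpl L1 →+* LocalCpl L := adicCompletionMap (maximalIdeal L1) (maximalIdeal L) lamL hmaple
  have hlamh : ∀ z : L1, lamh (algebraMap L1 (LocalCpl L1) z) = algebraMap L (LocalCpl L) (lamL z) := fun z =>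
    adicCompletionMap_of (maximalIdeal L1) (maximalIdeal L) lamL hmaple z
  have hmL : maximalIdeal (LocalCpl L) = (maximalIdeal L).map (algebraMap L (LocalCpl L)) :=
    AdicCompletion.maximalIdeal_eq_map
  have hmL1 : maximalIdeal (LocalCpl L1) = (maximalIdeal L1).map (algebraMap L1 (LocalCpl L1)) :=
    AdicCompletion.maximalIdeal_eq_map
  haveI hcplL : IsAdicComplete (maximalIdeal (LocalCpl L)) (LocalCpl L) := by
    rw [hmL]; exact AdicCompletion.isAdicComplete_self _ (maximalIdeal L).fg_of_isNoetherianRing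
  haveI hcplL1 : IsAdicComplete (maximalIdeal (LocalCpl L1)) (LocalCpl L1) := by
    rw [hmL1]; exact AdicCompletion.isAdicComplete_self _ (maximalIdeal L1).fg_of_isNoetherianRing
  -- the evaluation `Φ`
  let ev : Fin 2 → LocalCpl L := ![algebraMap L (LocalCpl L) (algebraMap (blowupAlgebra (Ideal.span (Set.range (![MvPowerSeries.X 0, MvPowerSeries.X 1, MvPowerSeries.C x, MvPowerSeries.C y] : Fin 4 → MvPowerSeries (Fin 2) A))) (MvPowerSeries.C x)) L (blowupAlgebra.gen (Ideal.span (Set.range (![MvPowerSeries.X 0, MvPowerSeries.X 1, MvPowerSeries.C x, MvPowerSeries.C y] : Fin 4 → MvPowerSeries (Fin 2) A))) (MvPowerSeries.C x) (MvPowerSeries.X 0) h0)), algebraMap L (LocalCpl L) (algebraMap (blowupAlgebra (Ideal.span (Set.range (![MvPowerSeries.X 0, MvPowerSeries.X 1, MvPowerSeries.C x, MvPowerSeries.C y] : Fin 4 → MvPowerSeries (Fin 2) A))) (MvPowerSeries.C x)) L (blowupAlgebra.gen (Ideal.span (Set.range (![MvPowerSeries.X 0, MvPowerSeries.X 1, MvPowerSeries.C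 x, MvPowerSeries.C y] : Fin 4 → MvPowerSeries (Fin 2) A))) (MvPowerSeries.C x) (MvPowerSeries.X 1) h1))]
  have hev : ∀ s, ev s ∈ maximalIdeal (LocalCpl L) := by
    intro s
    rw [hmL]
    fin_cases s
    · exact Ideal.mem_map_of_mem _ ((IsLocalization.AtPrime.to_map_mem_maximal_iff L 𝔔 _).mpr he0)
    · exact Ideal.mem_map_of_mem _ ((IsLocalization.AtPrime.to_map_mem_maximal_iff L 𝔔 _).mpr he1)
  obtain ⟨Φ₀, hΦ₀, -⟩ := exists_adicEvalHom (maximalIdeal (LocalCpl L)) ev hev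
  let Φ : MvPowerSeries (Fin 2) (LocalCpl L1) →+* LocalCpl L := Φ₀.comp (MvPowerSeries.map (σ := Fin 2) lamh)
  have hΦC : ∀ a', Φ (MvPowerSeries.C a') = lamh a' := by
    intro a'
    change Φ₀ (MvPowerSeries.map lamh (MvPowerSeries.C a')) = _
    rw [MvPowerSeries.map_C, ← MvPolynomial.coe_C, hΦ₀, MvPolynomial.eval_C]
  have hΦX : ∀ i, Φ (MvPowerSeries.X i) = ev i := by
    intro i
    change Φ₀ (MvPowerSeries.map lamh (MvPowerSeries.X i)) = _
    rw [MvPowerSeries.map_X, ← MvPolynomial.coe_X, hΦ₀, MvPolynomial.eval_X]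
  -- `Φ` sends `𝔪` into `𝔪`, and `𝔪_{L̂} ⊆ 𝔪 · L̂` along `Φ`
  have hΦm : (maximalIdeal (MvPowerSeries (Fin 2) (LocalCpl L1))).map Φ ≤ maximalIdeal (LocalCpl L) := by
    rw [maximalIdeal_mvPowerSeries_eq (LocalCpl L1) 2, Ideal.map_sup, Ideal.map_map, sup_le_iff]
    constructor
    · rw [hmL1, Ideal.map_map, Ideal.map_le_iff_le_comap]
      intro z hz
      rw [Ideal.mem_comap, RingHom.comp_apply, RingHom.comp_apply, hΦC, hlamh, hmL]
      exact Ideal.mem_map_of_mem _ (hmaple (Ideal.mem_map_of_mem _ hz))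
    · rw [Ideal.map_span, Ideal.span_le]
      rintro _ ⟨_, ⟨i, rfl⟩, rfl⟩
      rw [SetLike.mem_coe, hΦX]
      exact hev i
  have hmΦ : maximalIdeal (LocalCpl L) ≤ (maximalIdeal (MvPowerSeries (Fin 2) (LocalCpl L1))).map Φ := by
    rw [hmL]
    refine (Ideal.map_mono he.le).trans ?_
    rw [Ideal.map_sup, Ideal.map_span, Set.image_pair, Ideal.map_map, sup_le_iff]
    constructor
    · rw [Ideal.span_le, Set.pair_subset_iff]
      refine ⟨?_, ?_⟩
      · have : algebraMap L (LocalCpl L) (algebraMap (blowupAlgebra (Ideal.span (Set.range (![MvPowerSeries.X 0, MvPowerSeries.X 1, MvPowerSeries.C x, MvPowerSeries.C y] : Fin 4 → MvPowerSeries (Fin 2) A))) (MvPowerSeries.C x)) L (blowupAlgebra.gen (Ideal.span (Set.range (![MvPowerSeries.X 0, MvPowerSeries.X 1, MvPowerSeries.C x, MvPowerSeries.C y] : Fin 4 → MvPowerSeries (Fin 2) A))) (MvPowerSeries.C x) (MvPowerSeries.X 0) h0)) = Φ (MvPowerSeries.X 0) := (hΦX 0).symm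
        rw [SetLike.mem_coe, this]
        exact Ideal.mem_map_of_mem _ ((mem_maximalIdeal_mvPowerSeries_iff _ _).mpr (by simp))
      · have : algebraMap L (LocalCpl L) (algebraMap (blowupAlgebra (Ideal.span (Set.range (![MvPowerSeries.X 0, MvPowerSeries.X 1, MvPowerSeries.C x, MvPowerSeries.C y] : Fin 4 → MvPowerSeries (Fin 2) A))) (MvPowerSeries.C x)) L (blowupAlgebra.gen (Ideal.span (Set.range (![MvPowerSeries.X 0, MvPowerSeries.X 1, MvPowerSeries.C x, MvPowerSeries.C y] : Fin 4 → MvPowerSeries (Fin 2) A))) (MvPowerSeries.C x) (MvPowerSeries.X 1) h1)) = Φ (MvPowerSeries.X 1) := (hΦX 1).symm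
        rw [SetLike.mem_coe, this]
        exact Ideal.mem_map_of_mem _ ((mem_maximalIdeal_mvPowerSeries_iff _ _).mpr (by simp))
    · rw [Ideal.map_le_iff_le_comap]
      intro a ha'
      have hkey : ((algebraMap L (LocalCpl L)).comp ((algebraMap (blowupAlgebra (Ideal.span (Set.range (![MvPowerSeries.X 0, MvPowerSeries.X 1, MvPowerSeries.C x, MvPowerSeries.C y] : Fin 4 → MvPowerSeries (Fin 2) A))) (MvPowerSeries.C x)) L).comp lam)) a =
          Φ (MvPowerSeries.C (algebraMap L1 (LocalCpl L1) (algebraMap (blowupAlgebra (Ideal.span (Set.range ![x, y])) x) L1 a))) := by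
        rw [hΦC, hlamh, hlamL]; rfl
      rw [Ideal.mem_comap, hkey]
      refine Ideal.mem_map_of_mem _ ((mem_maximalIdeal_mvPowerSeries_iff _ _).mpr ?_)
      rw [MvPowerSeries.constantCoeff_C, hmL1]
      exact Ideal.mem_map_of_mem _ ((IsLocalization.AtPrime.to_map_mem_maximal_iff L1 (𝔔.comap lam) _).mpr ha')
  -- every element of `L̂` is congruent to an element of `Φ(C Â₁)` modulo `𝔪_{L̂}`
  have hres : ∀ m : LocalCpl L, ∃ r : MvPowerSeries (Fin 2) (LocalCpl L1), m - Φ r ∈ maximalIdeal (LocalCpl L) := by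
    intro m
    -- `L̂/𝔪L̂ = L/𝔪`
    obtain ⟨mz, hmz⟩ := (quotientMap_pow_bijective_adicCompletion (maximalIdeal L)
      (maximalIdeal L).fg_of_isNoetherianRing 1).2 (Ideal.Quotient.mk _ m)
    obtain ⟨z, rfl⟩ := Ideal.Quotient.mk_surjective mz
    rw [Ideal.quotientMap_mk, Ideal.Quotient.eq, pow_one] at hmz
    -- `z ≡ λ_L(z₁)` modulo `𝔪_L`
    obtain ⟨a, s, hs, hz⟩ := hf z
    have hunit : IsUnit (algebraMap (blowupAlgebra (Ideal.span (Set.range (![MvPowerSeries.X 0, MvPowerSeries.X 1, MvPowerSeries.C x, MvPowerSeries.C y] : Fin 4 → MvPowerSeries (Fin 2) A))) (MvPowerSeries.C x)) L (lam s)) := by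
      rw [← hlamL]
      exact (IsLocalization.map_units L1 (⟨s, hs⟩ : (𝔔.comap lam).primeCompl)).map lamL
    let z₁ : L1 := algebraMap (blowupAlgebra (Ideal.span (Set.range ![x, y])) x) L1 a * ((IsLocalization.map_units L1 (⟨s, hs⟩ : (𝔔.comap lam).primeCompl)).unit⁻¹ : L1ˣ)
    have hz₁ : lamL z₁ * algebraMap (blowupAlgebra (Ideal.span (Set.range (![MvPowerSeries.X 0, MvPowerSeries.X 1, MvPowerSeries.C x, MvPowerSeries.C y] : Fin 4 → MvPowerSeries (Fin 2) A))) (MvPowerSeries.C x)) L (lam s) = algebraMap (blowupAlgebra (Ideal.span (Set.range (![MvPowerSeries.X 0, MvPowerSeries.X 1, MvPowerSeries.C x, MvPowerSeries.C y] : Fin 4 → MvPowerSeries (Fin 2) A))) (MvPowerSeries.C x)) L (lam a) := by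
      change lamL (algebraMap (blowupAlgebra (Ideal.span (Set.range ![x, y])) x) L1 a * _) * _ = _
      rw [map_mul, hlamL, ← hlamL s, mul_assoc, ← map_mul, IsUnit.val_inv_mul, map_one, mul_one]
    have hzz : z - lamL z₁ ∈ maximalIdeal L := by
      have : (z - lamL z₁) * algebraMap (blowupAlgebra (Ideal.span (Set.range (![MvPowerSeries.X 0, MvPowerSeries.X 1, MvPowerSeries.C x, MvPowerSeries.C y] : Fin 4 → MvPowerSeries (Fin 2) A))) (MvPowerSeries.C x)) L (lam s) = z * algebraMap (blowupAlgebra (Ideal.span (Set.range (![MvPowerSeries.X 0, MvPowerSeries.X 1, MvPowerSeries.C x, MvPowerSeries.C y] : Fin 4 → MvPowerSeries (Fin 2) A))) (MvPowerSeries.C x)) L (lam s) - algebraMap (blowupAlgebra (Ideal.span (Set.range (![MvPowerSeries.X 0, MvPowerSeries.X 1, MvPowerSeries.C x, MvPowerSeries.C y] : Fin 4 → MvPowerSeries (Fin 2) A))) (MvPowerSeries.C x)) L (lam a) := by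
        rw [sub_mul, hz₁]
      have h2 : (z - lamL z₁) * algebraMap (blowupAlgebra (Ideal.span (Set.range (![MvPowerSeries.X 0, MvPowerSeries.X 1, MvPowerSeries.C x, MvPowerSeries.C y] : Fin 4 → MvPowerSeries (Fin 2) A))) (MvPowerSeries.C x)) L (lam s) ∈ maximalIdeal L := by rw [this]; exact hz
      rcases (Ideal.IsPrime.mul_mem_iff_mem_or_mem inferInstance).mp h2 with h | h
      · exact h
      · exact absurd h ((IsLocalRing.mem_maximalIdeal _).not.mpr (not_not.mpr hunit))
    refine ⟨MvPowerSeries.C (algebraMap L1 (LocalCpl L1) z₁), ?_⟩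
    rw [hΦC, hlamh, show m - algebraMap L (LocalCpl L) (lamL z₁) =
      algebraMap L (LocalCpl L) (z - lamL z₁) - (algebraMap L (LocalCpl L) z - m) by rw [map_sub]; ring]
    refine Ideal.sub_mem _ ?_ ?_
    · rw [hmL]; exact Ideal.mem_map_of_mem _ hzz
    · rw [hmL]; exact hmz
  -- SURJECTIVITY (Matsumura 8.4 for the module `L̂` over `R = Â₁⟦U, V⟧` via `Φ`)
  have hsurjΦ : Function.Surjective Φ := by
    letI : Algebra (MvPowerSeries (Fin 2) (LocalCpl L1)) (LocalCpl L) := Φ.toAlgebra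
    have halg : algebraMap (MvPowerSeries (Fin 2) (LocalCpl L1)) (LocalCpl L) = Φ := rfl
    haveI : IsAdicComplete (maximalIdeal (MvPowerSeries (Fin 2) (LocalCpl L1))) (MvPowerSeries (Fin 2) (LocalCpl L1)) :=
      isAdicComplete_maximalIdeal_mvPowerSeries (LocalCpl L1) 2
    haveI : IsHausdorff (maximalIdeal (MvPowerSeries (Fin 2) (LocalCpl L1))) (LocalCpl L) := by
      refine ⟨fun m hm => IsHausdorff.haus hcplL.toIsHausdorff m fun n => ?_⟩
      have hmn := hm n
      rw [SModEq.zero] at hmn ⊢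
      rw [Ideal.smul_top_eq_map, Submodule.restrictScalars_mem, Ideal.map_pow, halg] at hmn
      rw [smul_eq_mul, Ideal.mul_top]
      exact Ideal.pow_right_mono hΦm n hmn
    have hsup : Submodule.span (MvPowerSeries (Fin 2) (LocalCpl L1)) (Set.range fun _ : Unit => (1 : LocalCpl L)) ⊔
        ((maximalIdeal (MvPowerSeries (Fin 2) (LocalCpl L1))) • ⊤ : Submodule (MvPowerSeries (Fin 2) (LocalCpl L1)) (LocalCpl L)) = ⊤ := by
      refine Submodule.eq_top_iff'.mpr fun m => ?_
      obtain ⟨r, hr⟩ := hres m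
      rw [show m = r • (1 : LocalCpl L) + (m - Φ r) by rw [Algebra.smul_def, halg, mul_one]; ring]
      refine Submodule.add_mem_sup (Submodule.smul_mem _ r (Submodule.subset_span ⟨(), rfl⟩)) ?_
      rw [Ideal.smul_top_eq_map, Submodule.restrictScalars_mem, halg]
      exact hmΦ hr
    have htop := Matsumura1987_8_4 (maximalIdeal (MvPowerSeries (Fin 2) (LocalCpl L1))) _ hsup
    intro m
    have hm : m ∈ Submodule.span (MvPowerSeries (Fin 2) (LocalCpl L1)) (Set.range fun _ : Unit => (1 : LocalCpl L)) := by
      rw [htop]; exact Submodule.mem_top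
    rw [show Set.range (fun _ : Unit => (1 : LocalCpl L)) = {1} from Set.range_const, Submodule.mem_span_singleton] at hm
    obtain ⟨r, hr⟩ := hm
    exact ⟨r, by rw [← hr, Algebra.smul_def, halg, mul_one]⟩
  -- INJECTIVITY (a surjection of a domain of dimension `≤ dim L̂`)
  haveI : IsRegularLocalRing (LocalCpl L1) := isRegularLocalRing_adicCompletion L1
  haveI : IsDomain (LocalCpl L1) := isDomain_of_isRegularLocalRing _
  haveI : NoZeroDivisors (MvPowerSeries (Fin 2) (LocalCpl L1)) := inferInstance
  haveI : IsDomain (MvPowerSeries (Fin 2) (LocalCpl L1)) := NoZeroDivisors.to_isDomain _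
  haveI hLreg : IsRegularLocalRing L := by
    have := chartsOverCentre_isRsopPart_chartFamily_of_eq (![MvPowerSeries.X 0, MvPowerSeries.X 1, MvPowerSeries.C x, MvPowerSeries.C y] : Fin 4 → MvPowerSeries (Fin 2) A) 2 (fun k => MvPowerSeries.C (w k)) hzP hdP (Ideal.span (Set.range (![MvPowerSeries.X 0, MvPowerSeries.X 1, MvPowerSeries.C x, MvPowerSeries.C y] : Fin 4 → MvPowerSeries (Fin 2) A))) rfl hc
      (MvPowerSeries.C x) rfl 𝔔 h𝔔 L (a := 0) Fin.elim0 (Function.injective_of_subsingleton _) (fun t => Fin.elim0 t)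
    exact this.isRegularLocalRing
  have hdimLh : ringKrullDim (LocalCpl L) = ((l + 4 : ℕ) : WithBot ℕ∞) := by
    rw [show ringKrullDim (LocalCpl L) = ringKrullDim L from ringKrullDim_adicCompletion L, hdimL]
    congr 1
    push_cast
    ring_nf
  have hdimR : ringKrullDim (MvPowerSeries (Fin 2) (LocalCpl L1)) ≤ ((l + 4 : ℕ) : WithBot ℕ∞) := by
    refine (chartsOverCentre_ringKrullDim_mvPowerSeries_le (LocalCpl L1) 2).trans ?_
    rw [show ringKrullDim (LocalCpl L1) = ringKrullDim L1 from ringKrullDim_adicCompletion L1, hdim1]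
    push_cast
    exact le_of_eq (by ring)
  have hinjΦ : Function.Injective Φ :=
    chartsOverCentre_injective_of_surjective_of_ringKrullDim_le Φ hsurjΦ hdimLh hdimR
  refine ⟨RingEquiv.ofBijective Φ ⟨hinjΦ, hsurjΦ⟩, fun a₁ => ?_, ?_, ?_⟩
  · rw [RingEquiv.ofBijective_apply, hΦC, hlamh, hlamL]
  · rw [RingEquiv.ofBijective_apply, hΦX]; rfl
  · rw [RingEquiv.ofBijective_apply, hΦX]; rfl

end Summit.ResolutionOfSingularities.ResolutionOfSingularities.Theorems

end
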